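import Mathlib
import Summits.KontsevichZagierPeriods.Zeta5Search.EulerKernelBasisIntegrals
import Literature.NumberTheory.Transcendental.MultipleZetaWeightFiveProofs
import Literature.NumberTheory.Transcendental.MultipleZetaValuesBridgeProofs
import HarnessLib

/-!
# The Euler kernel, II: the depth-two input `B7 = ∫₀¹ E(u)² du/u = 2ζ(5)` via Tornheim's double series
# (cell `pub-zeta5`, seat ct-1 g21; item (3) of the wedge-dictionary programme, first deliverable, part 2)

HONEST FRAMING: systematic search; no irrationality claim unless certified.  Elementary real analysis plus the tree's
multiple zeta values: the ONE genuinely depth-two quantity among the basis integrals of gen-1 g17's human evaluation of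
the level-1 datum `D2 = I(1,0,1,0,1,1,0,1)` (`LEVEL1-EXACT.md` Theorem E, "The squares": `B7 = ∫E²/u = 2ζ5` through
Tornheim sums `T(2,2,1) + 2T(1,2,2) + 2T(1,1,3)` and the Euler sums `S_{1,4}`, `S_{2,3}`), for the kernel
`E(u) = Li₂(u) + log u · log(1 − u)` of `EulerKernelBasisIntegrals` (`Li₂ = reDilog`).

Method (everything in `ℝ≥0∞`, where rearrangements need no summability — as in the tree's
`MultipleZetaShuffleProofs`): square the non-negative series `E(u)/u = Σ aₙ(u)`, `aₙ(u) = uⁿ(1/(n+1)² + ℓ/(n+1))`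
(`ofReal_Ek_sq_div`), integrate termwise over `(0,1)` (Tonelli, `lintegral_tsum`; the moments
`∫₀¹ uᵐ ℓ^q = q!/(m+1)^{q+1}` of part 1), and recognise Tornheim's double series
`W(a,b,c) = Σ_{M,N ≥ 1} M^{−a} N^{−b} (M+N)^{−c}` written out in the tree's product coordinates:

  `∫₀¹ E²/u = W(2,2,1) + W(2,1,2) + W(1,2,2) + 2·W(1,1,3)`                       (`lintegral_Ek_sq_div`)
  `         = 4ζ(3,2) + 12ζ(4,1)`   (Euler's reduction `tsum_tornheim_succ_succ`, boundary values
                                     `tsum_tornheim_zero_left/right` of `MultipleZetaShuffleProofs`)  (`tornheim_combination_eq`)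
  `         = 2ζ(5)`                 (`multipleZeta_three_two_eq`, `multipleZeta_four_one_eq` of
                                     `MultipleZetaWeightFiveProofs`; the products `ζ(2)ζ(3)` cancel)  (`four_zeta32_add_twelve_zeta41`)

and **`integral_Ek_sq_div : IntegrableOn (E²/u) (0,1) ∧ ∫₀¹ E(u)² du/u = 2·zetaValue 5`**.
Theorems only; no notation, no definition, no named fact.  Nothing here mentions the cellular integrals; `ζ(5)` enters
only as the value of an absolutely convergent integral — nothing about its irrationality.
-/

noncomputable section

open MeasureTheory Set Filter Topology intervalIntegral
open scoped ENNReal Nat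

namespace Summit.KontsevichZagierPeriods.Zeta5Search.EulerKernel

open Literature.Analysis.SpecialFunctions (reDilog continuous_reDilog)
open Literature.NumberTheory.Transcendental (zetaValue multipleZeta tsum_tornheim_succ_succ tsum_tornheim_zero_left
  tsum_tornheim_zero_right multipleZeta_four_one_eq multipleZeta_three_two_eq multipleZeta_pos_of_isAdmissible_holds
  MZV.isAdmissible_pair multipleZeta_singleton_eq_zetaValue_of_ne_zero)

/-! ## 1. `E(u)²/u` as a double series and its termwise integral -/

/-- The double series of `E(u)²/u = u · (E(u)/u)²` in `ℝ≥0∞` on `(0,1)`. [folklore] -/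
theorem ofReal_Ek_sq_div (u : ℝ) (h0 : 0 < u) (h1 : u < 1) :
    ENNReal.ofReal ((reDilog u + Real.log u * Real.log (1 - u)) ^ 2 / u) =
      ∑' q : ℕ × ℕ, ENNReal.ofReal (u * ((u ^ q.1 * (1 / ((q.1 : ℝ) + 1) ^ 2 + (-Real.log u) / ((q.1 : ℝ) + 1))) *
        (u ^ q.2 * (1 / ((q.2 : ℝ) + 1) ^ 2 + (-Real.log u) / ((q.2 : ℝ) + 1))))) := by
  have hu : u ≠ 0 := h0.ne'
  have hq : (reDilog u + Real.log u * Real.log (1 - u)) ^ 2 / u =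
      u * (((reDilog u + Real.log u * Real.log (1 - u)) / u) * ((reDilog u + Real.log u * Real.log (1 - u)) / u)) := by
    field_simp
  have hE : 0 ≤ (reDilog u + Real.log u * Real.log (1 - u)) / u :=
    (hasSum_Ek_div h0 h1).nonneg (Ek_term_nonneg h0 h1)
  rw [hq, ENNReal.ofReal_mul h0.le, ENNReal.ofReal_mul hE, ofReal_Ek_div h0 h1, ← ENNReal.tsum_mul_right]
  simp_rw [← ENNReal.tsum_mul_left]
  rw [← ENNReal.tsum_prod]
  refine tsum_congr fun q => ?_
  rw [← ENNReal.ofReal_mul (Ek_term_nonneg h0 h1 _), ← ENNReal.ofReal_mul h0.le]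

/-- The termwise integral: for `m, n ≥ 0`, `∫₀¹ u · a_m(u) a_n(u) du` is the Tornheim summand
`1/(M²N²(M+N)) + 1/(M²N(M+N)²) + 1/(MN²(M+N)²) + 2/(MN(M+N)³)`, `M = m+1`, `N = n+1`. [folklore] -/
theorem lintegral_Ek_sq_term (m n : ℕ) :
    ∫⁻ u in Ioo (0:ℝ) 1, ENNReal.ofReal (u * ((u ^ m * (1 / ((m : ℝ) + 1) ^ 2 + (-Real.log u) / ((m : ℝ) + 1))) *
        (u ^ n * (1 / ((n : ℝ) + 1) ^ 2 + (-Real.log u) / ((n : ℝ) + 1))))) =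
      ENNReal.ofReal (1 / (((m : ℝ) + 1) ^ 2 * ((n : ℝ) + 1) ^ 2 * ((m : ℝ) + n + 2) ^ 1)) +
      ENNReal.ofReal (1 / (((m : ℝ) + 1) ^ 2 * ((n : ℝ) + 1) ^ 1 * ((m : ℝ) + n + 2) ^ 2)) +
      ENNReal.ofReal (1 / (((m : ℝ) + 1) ^ 1 * ((n : ℝ) + 1) ^ 2 * ((m : ℝ) + n + 2) ^ 2)) +
      2 * ENNReal.ofReal (1 / (((m : ℝ) + 1) ^ 1 * ((n : ℝ) + 1) ^ 1 * ((m : ℝ) + n + 2) ^ 3)) := by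
  -- expand the integrand into four moments on `(0,1)`
  have hexp : ∀ u ∈ Ioo (0:ℝ) 1,
      ENNReal.ofReal (u * ((u ^ m * (1 / ((m : ℝ) + 1) ^ 2 + (-Real.log u) / ((m : ℝ) + 1))) *
        (u ^ n * (1 / ((n : ℝ) + 1) ^ 2 + (-Real.log u) / ((n : ℝ) + 1))))) =
      ENNReal.ofReal (1 / (((m : ℝ) + 1) ^ 2 * ((n : ℝ) + 1) ^ 2) * (u ^ (m + n + 1) * (-Real.log u) ^ 0)) +
      ENNReal.ofReal (1 / (((m : ℝ) + 1) ^ 2 * ((n : ℝ) + 1)) * (u ^ (m + n + 1) * (-Real.log u) ^ 1)) +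
      ENNReal.ofReal (1 / (((m : ℝ) + 1) * ((n : ℝ) + 1) ^ 2) * (u ^ (m + n + 1) * (-Real.log u) ^ 1)) +
      ENNReal.ofReal (1 / (((m : ℝ) + 1) * ((n : ℝ) + 1)) * (u ^ (m + n + 1) * (-Real.log u) ^ 2)) := by
    intro u hu
    have hl : 0 ≤ -Real.log u := by rw [neg_nonneg]; exact Real.log_nonpos hu.1.le hu.2.le
    have h0 := hu.1.le
    rw [← ENNReal.ofReal_add (by positivity) (by positivity), ← ENNReal.ofReal_add (by positivity) (by positivity),
      ← ENNReal.ofReal_add (by positivity) (by positivity)]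
    congr 1
    field_simp
    ring
  rw [setLIntegral_congr_fun measurableSet_Ioo hexp]
  rw [lintegral_add_left (by fun_prop), lintegral_add_left (by fun_prop), lintegral_add_left (by fun_prop)]
  rw [lintegral_const_mul_pow_mul_negLog_pow _ (by positivity), lintegral_const_mul_pow_mul_negLog_pow _ (by positivity), lintegral_const_mul_pow_mul_negLog_pow _ (by positivity),
    lintegral_const_mul_pow_mul_negLog_pow _ (by positivity)]
  have e2 : (2 : ℝ≥0∞) = ENNReal.ofReal 2 := by simp
  rw [e2, ← ENNReal.ofReal_mul (by norm_num)]
  simp only [Nat.factorial, Nat.cast_succ, Nat.cast_zero, Nat.cast_add]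
  congr 1
  · congr 1
    · congr 1
      · congr 1; field_simp; ring
      · congr 1; field_simp; ring
    · congr 1; field_simp; ring
  · congr 1; field_simp; ring

/-! ## 2. `∫₀¹ E²/u` as the Tornheim combination `W(2,2,1) + W(2,1,2) + W(1,2,2) + 2W(1,1,3)` and its value `2ζ(5)` -/

/-- The basis integrand `E(u)²/u` is measurable. [folklore] -/
theorem measurable_Ek_sq_div :
    Measurable (fun u : ℝ => (reDilog u + Real.log u * Real.log (1 - u)) ^ 2 / u) := by
  have h : Continuous reDilog := continuous_reDilog
  fun_prop

/-- **`∫₀¹ E(u)² du/u` in `ℝ≥0∞` is a combination of Tornheim double series**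
`W(a,b,c) = Σ_{M,N ≥ 1} M^{−a} N^{−b} (M+N)^{−c}` (written out in the tree's product coordinates):
`∫⁻ E²/u = W(2,2,1) + W(2,1,2) + W(1,2,2) + 2·W(1,1,3)` — square the series of `E(u)/u` and integrate termwise
(Tonelli). [folklore] -/
theorem lintegral_Ek_sq_div :
    ∫⁻ u in Ioo (0:ℝ) 1, ENNReal.ofReal ((reDilog u + Real.log u * Real.log (1 - u)) ^ 2 / u) =
      (∑' p : ℕ × ℕ, ENNReal.ofReal (1 / (((p.1 : ℝ) + 1) ^ 2 * ((p.2 : ℝ) + 1) ^ 2 * ((p.1 : ℝ) + p.2 + 2) ^ 1))) +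
      (∑' p : ℕ × ℕ, ENNReal.ofReal (1 / (((p.1 : ℝ) + 1) ^ 2 * ((p.2 : ℝ) + 1) ^ 1 * ((p.1 : ℝ) + p.2 + 2) ^ 2))) +
      (∑' p : ℕ × ℕ, ENNReal.ofReal (1 / (((p.1 : ℝ) + 1) ^ 1 * ((p.2 : ℝ) + 1) ^ 2 * ((p.1 : ℝ) + p.2 + 2) ^ 2))) +
      2 * ∑' p : ℕ × ℕ, ENNReal.ofReal (1 / (((p.1 : ℝ) + 1) ^ 1 * ((p.2 : ℝ) + 1) ^ 1 * ((p.1 : ℝ) + p.2 + 2) ^ 3)) := by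
  rw [setLIntegral_congr_fun measurableSet_Ioo (fun u hu => ofReal_Ek_sq_div u hu.1 hu.2)]
  rw [lintegral_tsum (fun q => by
    apply Measurable.aemeasurable
    fun_prop)]
  rw [← ENNReal.tsum_mul_left, ← ENNReal.tsum_add, ← ENNReal.tsum_add, ← ENNReal.tsum_add]
  exact tsum_congr fun q => lintegral_Ek_sq_term q.1 q.2

/-- **The Tornheim reduction**: `W(2,2,1) + W(2,1,2) + W(1,2,2) + 2W(1,1,3) = 4ζ(3,2) + 12ζ(4,1)` in `ℝ≥0∞`, by Euler's
partial-fraction steps `W(a+1,b+1,c) = W(a,b+1,c+1) + W(a+1,b,c+1)` (`tsum_tornheim_succ_succ`) down to the boundary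
values `W(0,2,3) = W(2,0,3) = ζ(3,2)`, `W(0,1,4) = W(1,0,4) = ζ(4,1)` (`tsum_tornheim_zero_left/right`). [folklore] -/
theorem tornheim_combination_eq :
    (∑' p : ℕ × ℕ, ENNReal.ofReal (1 / (((p.1 : ℝ) + 1) ^ 2 * ((p.2 : ℝ) + 1) ^ 2 * ((p.1 : ℝ) + p.2 + 2) ^ 1))) +
      (∑' p : ℕ × ℕ, ENNReal.ofReal (1 / (((p.1 : ℝ) + 1) ^ 2 * ((p.2 : ℝ) + 1) ^ 1 * ((p.1 : ℝ) + p.2 + 2) ^ 2))) +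
      (∑' p : ℕ × ℕ, ENNReal.ofReal (1 / (((p.1 : ℝ) + 1) ^ 1 * ((p.2 : ℝ) + 1) ^ 2 * ((p.1 : ℝ) + p.2 + 2) ^ 2))) +
      2 * ∑' p : ℕ × ℕ, ENNReal.ofReal (1 / (((p.1 : ℝ) + 1) ^ 1 * ((p.2 : ℝ) + 1) ^ 1 * ((p.1 : ℝ) + p.2 + 2) ^ 3)) =
    ENNReal.ofReal (4 * multipleZeta [3, 2] + 12 * multipleZeta [4, 1]) := by
  have h221 := tsum_tornheim_succ_succ 1 1 1
  have h122 := tsum_tornheim_succ_succ 0 1 2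
  have h212 := tsum_tornheim_succ_succ 1 0 2
  have h113 := tsum_tornheim_succ_succ 0 0 3
  simp only [Nat.reduceAdd] at h221 h122 h212 h113
  have z023 := tsum_tornheim_zero_left (b := 2) (c := 3) (by norm_num) (by norm_num)
  have z203 := tsum_tornheim_zero_right (a := 2) (c := 3) (by norm_num) (by norm_num)
  have z014 := tsum_tornheim_zero_left (b := 1) (c := 4) (by norm_num) (by norm_num)
  have z104 := tsum_tornheim_zero_right (a := 1) (c := 4) (by norm_num) (by norm_num)
  rw [h221, h122, h212, h113, z023, z203, z014, z104]
  have h32 : 0 ≤ multipleZeta [3, 2] :=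
    (multipleZeta_pos_of_isAdmissible_holds (MZV.isAdmissible_pair (by norm_num) (by norm_num))).le
  have h41 : 0 ≤ multipleZeta [4, 1] :=
    (multipleZeta_pos_of_isAdmissible_holds (MZV.isAdmissible_pair (by norm_num) (by norm_num))).le
  rw [ENNReal.ofReal_add (by positivity) (by positivity), ENNReal.ofReal_mul (by norm_num),
    ENNReal.ofReal_mul (by norm_num), show ENNReal.ofReal 4 = 4 by simp, show ENNReal.ofReal 12 = 12 by simp]
  ring

/-- `4ζ(3,2) + 12ζ(4,1) = 2ζ(5)` — from the tree's weight-five evaluations `ζ(3,2) = 3ζ(2)ζ(3) − (11/2)ζ(5)`,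
`ζ(4,1) = 2ζ(5) − ζ(2)ζ(3)` (`MultipleZetaWeightFiveProofs`); the products `ζ(2)ζ(3)` cancel. [folklore] -/
theorem four_zeta32_add_twelve_zeta41 :
    4 * multipleZeta [3, 2] + 12 * multipleZeta [4, 1] = 2 * zetaValue 5 := by
  rw [multipleZeta_three_two_eq, multipleZeta_four_one_eq,
    ← multipleZeta_singleton_eq_zetaValue_of_ne_zero (by norm_num : (5:ℕ) ≠ 0)]
  ring

/-- **B7 — the one depth-two input of Theorem E**: `∫₀¹ E(u)² du/u = 2ζ(5)`, with integrability on `(0,1)`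
(`E(u) = Li₂(u) + log u log(1−u)`; human proof: gen-1 g17 `LEVEL1-EXACT.md` §4 via Tornheim sums
`T(2,2,1) + 2T(1,2,2) + 2T(1,1,3)` and the Euler sums `S_{1,4}`, `S_{2,3}`; here via the tree's `W(a,b,c)` reduction and
`ζ(3,2)`, `ζ(4,1)`). [folklore] -/
theorem integral_Ek_sq_div :
    IntegrableOn (fun u : ℝ => (reDilog u + Real.log u * Real.log (1 - u)) ^ 2 / u) (Ioo 0 1) ∧
      ∫ u in Ioo (0:ℝ) 1, (reDilog u + Real.log u * Real.log (1 - u)) ^ 2 / u = 2 * zetaValue 5 := by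
  have hL : ∫⁻ u in Ioo (0:ℝ) 1, ENNReal.ofReal ((reDilog u + Real.log u * Real.log (1 - u)) ^ 2 / u) =
      ENNReal.ofReal (2 * zetaValue 5) := by
    rw [lintegral_Ek_sq_div, tornheim_combination_eq, four_zeta32_add_twelve_zeta41]
  have h0 : 0 ≤ 2 * zetaValue 5 := by
    rw [← four_zeta32_add_twelve_zeta41]
    have h32 : 0 ≤ multipleZeta [3, 2] :=
      (multipleZeta_pos_of_isAdmissible_holds (MZV.isAdmissible_pair (by norm_num) (by norm_num))).le
    have h41 : 0 ≤ multipleZeta [4, 1] :=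
      (multipleZeta_pos_of_isAdmissible_holds (MZV.isAdmissible_pair (by norm_num) (by norm_num))).le
    positivity
  have hnn : 0 ≤ᵐ[volume.restrict (Ioo (0:ℝ) 1)]
      (fun u : ℝ => (reDilog u + Real.log u * Real.log (1 - u)) ^ 2 / u) :=
    (ae_restrict_mem measurableSet_Ioo).mono fun u hu => by
      have := hu.1.le
      positivity
  have hmeas := measurable_Ek_sq_div.aestronglyMeasurable (μ := volume.restrict (Ioo (0:ℝ) 1))
  refine ⟨⟨hmeas, ?_⟩, ?_⟩
  · rw [hasFiniteIntegral_iff_ofReal hnn, hL]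
    exact ENNReal.ofReal_lt_top
  · rw [integral_eq_lintegral_of_nonneg_ae hnn hmeas, hL, ENNReal.toReal_ofReal h0]

end Summit.KontsevichZagierPeriods.Zeta5Search.EulerKernel
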